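import Literature.Probability.Percolation.MarkedLoopTripodCharacter
import HarnessLib

/-!
# The necessity of the tripod law, for every number of marks, IS the joint injectivity of the face functionals on `ℂ^{Pic k}` («DOOR-U FORM»)

Topic `Literature/Probability/Percolation`; generic-`k` layer of the marked-loop (Khristoforov–Smirnov) lineage; a rider on `MarkedLoopTripodCharacter.lean` (REP: the relation
map `relMapΦ : (Pat k → ℂ) →ₗ (Pic k → ℂ)` with `ker_relMapΦ = solW k` and ★ `relMapΦ_surjective`; § Defect: the holomorphicity defect `holoDefect D v` of a pattern weight,
`holoDefect_eq_zero_of_mem_solW`, and ★★ `holoDefect_factors` — «at every face there is a linear functional `λ` on `ℂ^{Pic k}` with defect = `λ (Φ w)`; necessity — joint injectivity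
of the `λ`'s over all domains — is NOT claimed») and on `MarkedLoopTripodCuts.lean` (`mem_solW_iff_tripodLaw_classWt`), `MarkedLoopTripodBasis.lean` (`classWt`,
`holomorphicW_classWt`).

The lane's open door (U) is «for every odd `k`: a class weight holomorphic on every `k`-marked domain obeys the tripod law» (kernel theorems at `k = 3, 5, 7`:
RELINK-INDEX, NEC5, NEC7; exact numerics at `k = 9, 11, 13`: HOME `FINDING-TRIPOD-DOOR-U-TWO-CORNER.md`). This file gives the door its EXACT LINEAR-ALGEBRAIC FORM, for every `k`:

* `holoLam D v hv : (Pic k → ℂ) →ₗ[ℂ] ℂ` — THE FACE FUNCTIONAL at a face `v` with three `H_G`-sides (the `λ` of `holoDefect_factors`, now a named map: the defect pushed through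
  the quotient by `ker Φ = solW`), ★ `holoDefect_eq_holoLam_relMapΦ` (`holoDefect D v w = holoLam D v hv (Φ w)` for EVERY pattern weight `w`), `holoLam_unique` (the only
  functional with this property, `Φ` being onto);
* `holomorphicW_classWt_iff_holoDefect` — a pattern weight's class weight is holomorphic on `D` iff all its face defects on `D` vanish;
* ★★★ `necessity_iff_holoLam_jointly_injective` — **FOR EVERY `k`: «every pattern weight whose class weight is holomorphic on every `k`-marked domain obeys the tripod
  law» ⟺ «the face functionals `holoLam D v` of all faces of all `k`-marked domains have no common non-zero kernel vector in `ℂ^{Pic k}`»** (equivalently: they SPAN the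
  dual of `ℂ^{Pic k}`) — the statement the lane's census certificates instantiate (NEC7: three two-corner faces of one rhombus × 7 rotations; numerically 10 / 3·22 / 20·30
  faces at `k = 9 / 11 / 13`); `tripodLaw_of_forall_holomorphicW_of_jointly_injective` / `jointly_injective_of_necessity` (the two directions by name).

## References
* M. Khristoforov, S. Smirnov, *Percolation and O(1) loop model*, arXiv:2111.15612 (2021), §2 Lemma 4, proof and Fig. 3 (arXiv v1 p. 4: the grouping of configurations in
  triples, «each triple contributes zero» — sufficiency; the converse is the lane's question).
* B. Bollobás, O. Riordan, *Percolation*, CUP (2006), Ch. 7 §7.2.2 (pp. 191–195: marked discrete domains).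

## Mathlib / tree
Tree: `MarkedLoopTripodCharacter.lean` (`relMapΦ`, `ker_relMapΦ`, `relMapΦ_surjective`, `holoDefect`, `holoDefect_apply`, `holoDefect_eq_zero_of_mem_solW`), `MarkedLoopTripodCuts.lean`
(`mem_solW_iff_tripodLaw_classWt`), `MarkedLoopTripodBasis.lean` (`classWt`), `MarkedLoopHolomorphy.lean` (`HolomorphicW`, `TripodLaw`, `AllSides`). Mathlib: `Submodule.liftQ`,
`LinearMap.quotKerEquivOfSurjective`, `LinearMap.mem_ker`.
-/

namespace Literature.Probability.Percolation.MarkedLoops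

open Literature.Probability.Percolation Literature.Probability.LatticeModels
open Literature.Probability.Percolation.FivePoint (tau)
open TriMarkedDomain

section Form

variable {nm : ℕ} (D : TriMarkedDomain nm)

/-- the defect kills `ker Φ`. [cite: KhristoforovSmirnov2021, §2 Lemma 4 (arXiv v1 p. 4)] -/
theorem ker_relMapΦ_le_ker_holoDefect {v : HexVertex} (hv : AllSides D v) : LinearMap.ker (relMapΦ nm) ≤ LinearMap.ker (holoDefect D v) := by
  intro w hw
  rw [ker_relMapΦ] at hw
  exact (LinearMap.mem_ker).2 (holoDefect_eq_zero_of_mem_solW hv hw)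

/-- ★ **THE FACE FUNCTIONAL** `λ_{D,v} : ℂ^{Pic k} →ₗ ℂ` at a face with three `H_G`-sides: the holomorphicity defect pushed through `Φ` (well defined because the defect kills
`ker Φ = solW`, and `Φ` is onto). [cite: KhristoforovSmirnov2021, §2 Lemma 4, proof and Fig. 3 (arXiv v1 p. 4)] -/
noncomputable def holoLam (v : HexVertex) (hv : AllSides D v) : (Pic nm → ℂ) →ₗ[ℂ] ℂ :=
  (LinearMap.ker (relMapΦ nm)).liftQ (holoDefect D v) (ker_relMapΦ_le_ker_holoDefect D hv) ∘ₗ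
    ((relMapΦ nm).quotKerEquivOfSurjective relMapΦ_surjective).symm.toLinearMap

variable {D}

/-- ★ **the defect of EVERY pattern weight is the face functional applied to its tripod-relation values**: `holoDefect D v w = λ_{D,v} (Φ w)`.
[cite: KhristoforovSmirnov2021, §2 Lemma 4, proof and Fig. 3 (arXiv v1 p. 4)] -/
theorem holoDefect_eq_holoLam_relMapΦ {v : HexVertex} (hv : AllSides D v) (w : Pat nm → ℂ) : holoDefect D v w = holoLam D v hv (relMapΦ nm w) := by
  rw [holoLam, LinearMap.comp_apply, LinearEquiv.coe_toLinearMap, LinearMap.quotKerEquivOfSurjective_symm_apply, Submodule.liftQ_apply]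

/-- the face functional is the ONLY functional through which the defect factors (`Φ` is onto). [cite: KhristoforovSmirnov2021, §2 Lemma 4 (arXiv v1 p. 4)] -/
theorem holoLam_unique {v : HexVertex} (hv : AllSides D v) {lam : (Pic nm → ℂ) →ₗ[ℂ] ℂ} (h : ∀ w : Pat nm → ℂ, holoDefect D v w = lam (relMapΦ nm w)) :
    lam = holoLam D v hv := by
  apply LinearMap.ext
  intro θ
  obtain ⟨w, rfl⟩ := relMapΦ_surjective θ
  rw [← h w, holoDefect_eq_holoLam_relMapΦ hv]

/-- a pattern weight's class weight is holomorphic on `D` iff all its face defects on `D` vanish. [cite: KhristoforovSmirnov2021, §2 Lemma 4 eq. (3) (arXiv v1 p. 4)] -/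
theorem holomorphicW_classWt_iff_holoDefect (D : TriMarkedDomain nm) (w : Pat nm → ℂ) :
    HolomorphicW D (classWt w) ↔ ∀ v : HexVertex, AllSides D v → holoDefect D v w = 0 := by
  constructor
  · intro h v hv
    rw [holoDefect_apply]
    exact h v hv
  · intro h v hv
    rw [← holoDefect_apply]
    exact h v hv

/-- ★★ **NECESSITY FROM JOINT INJECTIVITY**: if the face functionals of all faces of all `k`-marked domains have no common non-zero kernel vector, then every pattern weight
whose class weight is holomorphic on every `k`-marked domain obeys the tripod law. [cite: KhristoforovSmirnov2021, §2 Lemma 4 (arXiv v1 p. 4); BollobasRiordan2006, Ch. 7 §7.2.2 (pp. 191–195)] -/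
theorem tripodLaw_of_forall_holomorphicW_of_jointly_injective
    (hinj : ∀ θ : Pic nm → ℂ, (∀ (D : TriMarkedDomain nm) (v : HexVertex) (hv : AllSides D v), holoLam D v hv θ = 0) → θ = 0)
    {w : Pat nm → ℂ} (hw : ∀ D : TriMarkedDomain nm, HolomorphicW D (classWt w)) : TripodLaw (classWt w) := by
  rw [← mem_solW_iff_tripodLaw_classWt, ← ker_relMapΦ, LinearMap.mem_ker]
  apply hinj
  intro D v hv
  rw [← holoDefect_eq_holoLam_relMapΦ hv]
  exact ((holomorphicW_classWt_iff_holoDefect D w).1 (hw D)) v hv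

/-- ★★ **JOINT INJECTIVITY FROM NECESSITY**: conversely, if every such pattern weight obeys the tripod law, the face functionals have no common non-zero kernel vector (`Φ` is
onto: a kernel vector is `Φ w` for some `w`, whose class weight is then holomorphic everywhere, hence `w ∈ solW = ker Φ`).
[cite: KhristoforovSmirnov2021, §2 Lemma 4 (arXiv v1 p. 4); BollobasRiordan2006, Ch. 7 §7.2.2 (pp. 191–195)] -/
theorem jointly_injective_of_necessity
    (hnec : ∀ w : Pat nm → ℂ, (∀ D : TriMarkedDomain nm, HolomorphicW D (classWt w)) → TripodLaw (classWt w))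
    {θ : Pic nm → ℂ} (hθ : ∀ (D : TriMarkedDomain nm) (v : HexVertex) (hv : AllSides D v), holoLam D v hv θ = 0) : θ = 0 := by
  obtain ⟨w, rfl⟩ := relMapΦ_surjective θ
  have hw : ∀ D : TriMarkedDomain nm, HolomorphicW D (classWt w) := fun D =>
    (holomorphicW_classWt_iff_holoDefect D w).2 fun v hv => by rw [holoDefect_eq_holoLam_relMapΦ hv]; exact hθ D v hv
  have hsol : w ∈ solW nm := mem_solW_iff_tripodLaw_classWt.2 (hnec w hw)
  rw [← ker_relMapΦ, LinearMap.mem_ker] at hsol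
  exact hsol

/-- ★★★ **DOOR (U) IN LINEAR-ALGEBRAIC FORM, FOR EVERY NUMBER OF MARKS**: «every pattern weight whose class weight is holomorphic on every `k`-marked domain obeys the tripod
law» ⟺ «the face functionals `λ_{D,v}` on `ℂ^{Pic k}` of all faces of all `k`-marked domains are JOINTLY INJECTIVE (equivalently: span the dual space)». The lane's
certificates are finite sub-families that are already jointly injective (NEC7: three faces of one rhombus and its seven rotations).
[cite: KhristoforovSmirnov2021, §2 Lemma 4, proof and Fig. 3 (arXiv v1 p. 4); BollobasRiordan2006, Ch. 7 §7.2.2 (pp. 191–195)] -/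
theorem necessity_iff_holoLam_jointly_injective :
    (∀ w : Pat nm → ℂ, (∀ D : TriMarkedDomain nm, HolomorphicW D (classWt w)) → TripodLaw (classWt w)) ↔
      (∀ θ : Pic nm → ℂ, (∀ (D : TriMarkedDomain nm) (v : HexVertex) (hv : AllSides D v), holoLam D v hv θ = 0) → θ = 0) :=
  ⟨fun hnec _ hθ => jointly_injective_of_necessity hnec hθ, fun hinj _ hw => tripodLaw_of_forall_holomorphicW_of_jointly_injective hinj hw⟩

end Form

end Literature.Probability.Percolation.MarkedLoops
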